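import Summits.CriticalPhenomena.CardyFormulaZ2.Theorems.CardyBoundaryCoulombGasRectilinearCardyStubEventIdentityPart3
import Summits.CriticalPhenomena.CardyFormulaZ2.Theorems.CardyBoundaryCoulombGasRectilinearCardyStubEventIdentityPart10

/-!
# Stub `stub_eventIdentity` of line `excursion-kernel-covariance` (crux `RectilinearCardy`,
# stmt-CriticalPhenomena-5660) — Part 12: the rainbow pairing forces the hull event
# (exclusion W2 of the design `Lines/excursion-kernel-covariance-eventIdentity-design.md`)

Setting of Parts 6–10. THEOREM `ei_hull_of_pairing`: if the strands pair `e_v'' → e_A`,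
`e_B → e_v'`, `e_X → e_C`, then `v ≈ W₁` and `¬ W₂ ≈ W₁`.

* `ei_orbit_symm`, `ei_joinedIn_symm`, `ei_vertH_nextCorner_of_not_targetsLive`,
  `ei_exists_last_tracked` — bookkeeping: orbits of the (bijective) turning rule are symmetric;
  `≈` is symmetric; the vertex level does not change across a corner whose target is not live;
  the last tracked corner before an untracked one along an orbit;
* `ei_sep_of_pairing` — **`¬ W₂ ≈ W₁`**: otherwise `g_B ~β X` (spoke, chain `W₁`, the `ω`-path,
  chain `W₂`), and the winding lemma (Part 3, with `q₁ = e_B`, `q₂ = e_v'` on the orbit loop `L` of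
  `e_v''`, `r = (X, K)`, `cFace r = cFace e_v' = F_Xv`) puts `(X, K) = σ e_X` on `L`, hence `e_X` on
  `L`, preceded by the untracked `(g_X, K)`; scanning `L` backwards from there to the last tracked
  corner finds an exit, `e_A` or `e_C` (Part 9), with the vertex level constant in between
  (Parts 8, here): `e_A` would give `vertH g_A = vertH g_X`, i.e. `-1 = -3`; `e_C` would make the
  loop close up inside the stretch from `e_C` back to `e_C` through `e_X`'s strand, where the only
  tracked corners are strand corners, none of which is preceded by the cut `e_v'` — but `e_v''` is;
* `ei_joined_W1_of_pairing` — **`v ≈ W₁`**: the strand `e_v'' → e_A` gives `v ~β g_A`, and the CLASS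
  LEMMA at level `-1` (Part 10, using `¬ W₂ ≈ W₁`) says that the cluster of `g_A` meets `V` only in
  vertices `≈`-joined to `W₁`.

All [folklore]; no new objects.
-/

namespace Summit.CriticalPhenomena.CardyFormulaZ2.Cruxes.RectilinearCardy.ExcursionKernelCovariance

open Finset Literature.Probability.LatticeModels Literature.Probability.LatticeModels.CollarLegModel
open Summit.CriticalPhenomena.CardyFormulaZ2.Cruxes.BoundaryDefectGaussianR.RainbowMonomialsInExcursionKernels
open Literature.Probability.Percolation (openGraph openGraph_adj)

/-- **Orbits of periodic points are symmetric**: if `d` is on the orbit of the periodic point `c`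
then `c` is on the orbit of `d`. [folklore] -/
theorem ei_orbit_symm {α : Type*} {f : α → α} {c d : α} (hc : c ∈ Function.periodicPts f)
    (h : ∃ k, f^[k] c = d) : ∃ m, f^[m] d = c := by
  obtain ⟨p, hp, hper⟩ := Function.mem_periodicPts.1 hc
  obtain ⟨k, rfl⟩ := h
  refine ⟨(p - 1) * k, ?_⟩
  rw [← Function.iterate_add_apply, show (p - 1) * k + k = p * k by
    rcases p with _ | p
    · omega
    · simp [Nat.succ_mul]]
  exact (hper.mul_const k).eq

/-- `≈` (joined by edges of `ω`) is symmetric. [folklore] -/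
theorem ei_joinedIn_symm {ω : Finset ((ℤ × ℤ) × Bool)} {a b : ℤ × ℤ}
    (h : Relation.ReflTransGen (fun b c : ℤ × ℤ ↦ ∃ e ∈ ω, (e.1 = b ∧ SixVertex.edgeTip e = c) ∨ (e.1 = c ∧ SixVertex.edgeTip e = b)) a b) : Relation.ReflTransGen (fun b c : ℤ × ℤ ↦ ∃ e ∈ ω, (e.1 = b ∧ SixVertex.edgeTip e = c) ∨ (e.1 = c ∧ SixVertex.edgeTip e = b)) b a := by
  induction h with
  | refl => exact Relation.ReflTransGen.refl
  | tail _ hstep ih =>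
    obtain ⟨e, he, hor⟩ := hstep
    exact Relation.ReflTransGen.head ⟨e, he, hor.symm⟩ ih

/-- **The last tracked corner before an untracked one.** Along an orbit, if position `j₁` is tracked
and position `j₂ > j₁` is not, some position `i ∈ [j₁, j₂)` is tracked with all positions in
`(i, j₂]` untracked. [folklore] -/
theorem ei_exists_last_tracked (M : CollarLegModel) (σ : Site 2 × Fin 4 → Site 2 × Fin 4)
    (c : Site 2 × Fin 4) {j₁ j₂ : ℕ} (hlt : j₁ < j₂) (h₁ : M.IsTracked (σ^[j₁] c))
    (h₂ : ¬M.IsTracked (σ^[j₂] c)) :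
    ∃ i, j₁ ≤ i ∧ i < j₂ ∧ M.IsTracked (σ^[i] c) ∧ ∀ i', i < i' → i' ≤ j₂ → ¬M.IsTracked (σ^[i'] c) := by
  induction j₂, hlt using Nat.le_induction with
  | base => exact ⟨j₁, le_rfl, Nat.lt_succ_self _, h₁, fun i' hi hi' => by
      have : i' = j₁ + 1 := by omega
      subst this; exact h₂⟩
  | succ j₂ hj ih =>
    by_cases ht : M.IsTracked (σ^[j₂] c)
    · exact ⟨j₂, by omega, Nat.lt_succ_self _, ht, fun i' hi hi' => by
        have : i' = j₂ + 1 := by omega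
        subst this; exact h₂⟩
    · obtain ⟨i, hi1, hi2, hti, hun⟩ := ih ht
      exact ⟨i, hi1, by omega, hti, fun i' hi hi' => by
        rcases Nat.lt_or_ge i' (j₂ + 1) with h | h
        · exact hun i' hi (by omega)
        · have : i' = j₂ + 1 := by omega
          subst this; exact h₂⟩

section RainbowToHull

variable {ι : LegInsertionData} {V : Finset (ℤ × ℤ)} {d₀ : Dart} {iA iB iC : ℕ}
  (hadm : ι.IsAdmissible V)
  (hflat : ∀ x ∈ insert ι.sink ι.source, ∃ dvec : ℤ × ℤ,
      (dvec = (1, 0) ∨ dvec = (-1, 0) ∨ dvec = (0, 1) ∨ dvec = (0, -1)) ∧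
      ∀ v : ℤ × ℤ, (v.1 - x.1) ^ 2 + (v.2 - x.2) ^ 2 ≤ ((ι.sinkLegs : ℤ) + 3) ^ 2 →
        (v ∈ V ↔ 0 ≤ (v.1 - x.1) * dvec.1 + (v.2 - x.2) * dvec.2))
  (hchart : ∀ u ∈ V, ∀ k : Fin 4, u + dir k ∉ V → ∃ (K : Fin 4) (c₁ c₂ : ℤ),
      (∀ v : ℤ × ℤ, |v.1 - u.1| ≤ 3 → |v.2 - u.2| ≤ 3 →
        (v ∈ V ↔ c₂ ≤ v.1 * (dir (K + 1)).1 + v.2 * (dir (K + 1)).2)) ∨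
      (∀ v : ℤ × ℤ, |v.1 - u.1| ≤ 3 → |v.2 - u.2| ≤ 3 →
        (v ∈ V ↔ c₁ ≤ v.1 * (dir K).1 + v.2 * (dir K).2 ∧
          c₂ ≤ v.1 * (dir (K + 1)).1 + v.2 * (dir (K + 1)).2)) ∨
      (∀ v : ℤ × ℤ, |v.1 - u.1| ≤ 3 → |v.2 - u.2| ≤ 3 →
        (v ∈ V ↔ c₂ ≤ v.1 * (dir (K + 1)).1 + v.2 * (dir (K + 1)).2 ∨
          v.1 * (dir K).1 + v.2 * (dir K).2 ≤ c₁)))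
  (hv₀ : d₀.1 ∈ V) (ht₀ : dartTip d₀ ∉ V) (hout : outDart V d₀.1 = some d₀)
  (h2 : 2 ≤ iA) (hAB : iA < iB) (hBC : iB < iC) (hCP : iC < period V d₀)
  (hcA : ((neighbours ((dsucc V)^[iA] d₀).1).filter (fun y ↦ y ∉ V)).card = 1)
  (hcB : ((neighbours ((dsucc V)^[iB] d₀).1).filter (fun y ↦ y ∉ V)).card = 1)
  (hcC : ((neighbours ((dsucc V)^[iC] d₀).1).filter (fun y ↦ y ∉ V)).card = 1)
  (hsrc : ι.source = {((dsucc V)^[iA] d₀).1, ((dsucc V)^[iB] d₀).1, ((dsucc V)^[iC] d₀).1})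
  (hlegs : ∀ x ∈ ι.source, ι.legs x = 1) (hsink : ι.sink = d₀.1) (hsl : ι.sinkLegs = 3)

include hadm hflat hchart in
/-- **The vertex level does not change across a corner whose target is not live** (closed: same
vertex; frozen open: `openEdges_vertH_eq`). [folklore] -/
theorem ei_vertH_nextCorner_of_not_targetsLive {ω : Finset ((ℤ × ℤ) × Bool)} (hω : ω ⊆ (ι.model V).E)
    {c : Site 2 × Fin 4} (hc : ¬(ι.model V).TargetsLive c) :
    (ι.collar V).vertH (ofSite (nextCorner ((ι.model V).cfgOf ω) c).1) = (ι.collar V).vertH (ofSite c.1) := by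
  by_cases hb : cTgt c ∈ (ι.model V).cfgOf ω
  · rw [nextCorner_of_mem hb]
    simp only
    rw [ei_ofSite_add_cornerUnit]
    obtain ⟨e, hce, hend⟩ := se_corner_edge (ofSite c.1) c.2
    rw [ei_corner_eq c] at hb hc
    rcases (se_cTgt_mem_cfgOf_iff (ι.model V) ω hce).1 hb with he | he
    · exfalso
      apply hc
      have hE := hω he
      rw [E, inducedEdges, mem_filter] at hE
      rw [se_targetsLive_iff]
      rcases hend with ⟨h1, h2⟩ | ⟨h1, h2⟩
      · exact ⟨h1 ▸ hE.2.1, h2 ▸ hE.2.2⟩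
      · exact ⟨h2 ▸ hE.2.2, h1 ▸ hE.2.1⟩
    · have hlev : (ι.collar V).vertH e.1 = (ι.collar V).vertH (SixVertex.edgeTip e) :=
        openEdges_vertH_eq ι V hadm hflat hchart he
      rcases hend with ⟨h1, h2⟩ | ⟨h1, h2⟩
      · rw [h1, h2] at hlev; exact hlev.symm
      · rw [h1, h2] at hlev; exact hlev
  · rw [nextCorner_of_not_mem hb]

include hadm hflat hchart hv₀ ht₀ hout h2 hAB hBC hCP hcA hcB hcC hsrc hlegs hsink hsl in
/-- **The rainbow pairing separates the two wired blocks (`¬ W₂ ≈ W₁`).**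
[cite: BaxterKellandWu1976, §3–§4] -/
theorem ei_sep_of_pairing {ω : Finset ((ℤ × ℤ) × Bool)} (hω : ω ⊆ (ι.model V).E)
    (hJA : (ι.model V).Joined ω (toSite ((dsucc V)^[1] d₀).1, ((dsucc V)^[1] d₀).2) (toSite (dartTip ((dsucc V)^[iA] d₀)), ((dsucc V)^[iA] d₀).2 + 2)) (hJB : (ι.model V).Joined ω (toSite (dartTip ((dsucc V)^[iB] d₀)), ((dsucc V)^[iB] d₀).2 + 1) (toSite ((dsucc V)^[1] d₀).1, ((dsucc V)^[1] d₀).2 + 3)) (hJX : (ι.model V).Joined ω (toSite (dartTip d₀), d₀.2 + 1) (toSite (dartTip ((dsucc V)^[iC] d₀)), ((dsucc V)^[iC] d₀).2 + 2)) :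
    ¬∃ y, (y = d₀.1 ∨ ∃ s, iC ≤ s ∧ s < period V d₀ ∧ ((dsucc V)^[s] d₀).1 = y) ∧ ∃ x, (∃ s, iA ≤ s ∧ s ≤ iB ∧ ((dsucc V)^[s] d₀).1 = x) ∧ Relation.ReflTransGen (fun b c : ℤ × ℤ ↦ ∃ e ∈ ω, (e.1 = b ∧ SixVertex.edgeTip e = c) ∨ (e.1 = c ∧ SixVertex.edgeTip e = b)) y x := by
  rintro ⟨y, hy, x, ⟨s, hs, hs', rfl⟩, hJyx⟩
  obtain ⟨hs0, hs1, hs2, hsA, hsA1, hsB, -⟩ := ei_states hv₀ ht₀ hout h2 hAB hBC hCP hcA hcB hcC hsrc hlegs hsink hsl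
  obtain ⟨htrX, htr1, htr2, htrA, htrB, htrC⟩ := ei_ends_tracked hadm hflat hv₀ ht₀ hout h2 hAB hBC hCP hcA hcB hcC hsrc hlegs hsink hsl
  obtain ⟨h1c, -, -, -, hAc, -, hCc⟩ := ei_ends_cut hadm hflat hv₀ ht₀ hout h2 hAB hBC hCP hcA hcB hcC hsrc hlegs hsink hsl
  obtain ⟨hgA, -, hgX, -⟩ := ei_ghost_levels hadm hflat hchart hv₀ ht₀ hout h2 hAB hBC hCP hcA hcB hcC hsrc hlegs hsink hsl
  obtain ⟨-, ⟨-, h1n⟩, -⟩ := ei_start_pred hadm hflat hv₀ ht₀ hout h2 hAB hBC hCP hcA hcB hcC hsrc hlegs hsink hsl hω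
  obtain ⟨⟨hnX, hσX⟩, -⟩ := ei_pred_starts hadm hflat hchart hv₀ ht₀ hout h2 hAB hBC hCP hcA hcB hcC hsrc hlegs hsink hsl hω
  have hext : ∀ i, ((dsucc V)^[i] d₀).1 ∈ V ∧ dartTip ((dsucc V)^[i] d₀) ∉ V :=
    fun i => (s3_dsucc_iterate V i).1 d₀ hv₀ ht₀
  set σ := nextCorner ((ι.model V).cfgOf ω) with hσ
  have hinj : Function.Injective σ := nextCorner_injective
  obtain ⟨nA, -, hitA, hbefA⟩ := hJA
  obtain ⟨nB, -, hitB, -⟩ := hJB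
  obtain ⟨nX, -, hitX, hbefX⟩ := hJX
  have hp : (toSite ((dsucc V)^[1] d₀).1, ((dsucc V)^[1] d₀).2) ∈ Function.periodicPts σ := ei_mem_periodicPts hω _
  -- `e_B` and `e_v'` on the orbit of `e_v''`
  have hB1 : σ^[nB + 1] (toSite (dartTip ((dsucc V)^[iB] d₀)), ((dsucc V)^[iB] d₀).2 + 1) = (toSite ((dsucc V)^[1] d₀).1, ((dsucc V)^[1] d₀).2) := by rw [Function.iterate_succ_apply', hitB, h1n]
  obtain ⟨mB, hmB⟩ : ∃ m, σ^[m] (toSite ((dsucc V)^[1] d₀).1, ((dsucc V)^[1] d₀).2) = (toSite (dartTip ((dsucc V)^[iB] d₀)), ((dsucc V)^[iB] d₀).2 + 1) := ei_orbit_symm (ei_mem_periodicPts hω _) ⟨nB + 1, hB1⟩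
  have hm1 : σ^[nB + mB] (toSite ((dsucc V)^[1] d₀).1, ((dsucc V)^[1] d₀).2) = (toSite ((dsucc V)^[1] d₀).1, ((dsucc V)^[1] d₀).2 + 3) := by rw [Function.iterate_add_apply, hmB, hitB]
  -- the sink's vertex `X` is `β`-joined to `g_B`
  have hBarc : ((dsucc V)^[iB] d₀).1 ∈ (ι.model V).arcVerts :=
    ei_arc_of_wired hout hsink (by omega) (hext iB).1 (Or.inl (by rw [hsB]))
  have hv : (openGraph ((ι.model V).cfgOf ω) ⊓ zdGraph 2).Reachable (toSite (dartTip ((dsucc V)^[iB] d₀)), ((dsucc V)^[iB] d₀).2 + 1).1 (toSite d₀.1, d₀.2).1 := by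
    have r1 := (ei_reachable_spoke (M := (ι.model V)) (ω := ω) hBarc (hext iB).2).symm
    have r2 := (ei_reach_chain1 hv₀ ht₀ hout h2 hAB hBC hCP hcA hcB hcC hsrc hlegs hsink hsl ω (s := iB) hAB.le le_rfl).symm.trans
      (ei_reach_chain1 hv₀ ht₀ hout h2 hAB hBC hCP hcA hcB hcC hsrc hlegs hsink hsl ω hs hs')
    have r3 := (ei_reach_of_joinedIn (ι.model V) hJyx).symm
    have r4 : (openGraph ((ι.model V).cfgOf ω) ⊓ zdGraph 2).Reachable (toSite y) (toSite d₀.1) := by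
      rcases hy with rfl | ⟨s', hs1, hs2, rfl⟩
      · exact SimpleGraph.Reachable.refl _
      · exact ei_reach_chain2 hv₀ ht₀ hout h2 hAB hBC hCP hcA hcB hcC hsrc hlegs hsink hsl ω hs1 hs2.le
    exact ((r1.trans r2).trans r3).trans r4
  -- the face of `r = (X, K)` is the face of `e_v'`
  have hds : dsucc V d₀ = (((dsucc V)^[1] d₀).1, ((dsucc V)^[1] d₀).2) := rfl
  have hface : cFace (toSite ((dsucc V)^[1] d₀).1, ((dsucc V)^[1] d₀).2 + 3) = cFace (toSite d₀.1, d₀.2) := by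
    apply ei_ofSite_injective
    have e1 : gapFace d₀ = ofSite (cFace (toSite ((dsucc V)^[1] d₀).1, ((dsucc V)^[1] d₀).2 + 3)) := ei_gapFace_dsucc_site hds
    have e2 : gapFace (d₀.1, d₀.2) = ofSite (cFace (toSite d₀.1, d₀.2)) := ei_gapFace_site _ _
    rw [← e1, ← e2]
  obtain ⟨m, hm⟩ := ei_mem_orbit_of_wind hp ⟨mB, hmB⟩ ⟨nB + mB, hm1⟩ hv (by rw [hface])
  -- `σ e_X = r` along the open spoke `{g_X, X}`
  have hXarc : d₀.1 ∈ (ι.model V).arcVerts := ei_arc_of_wired (ι := ι) hout hsink (i := 0) (by omega) hv₀ (Or.inl (by rw [hs0]))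
  have hneg : ∀ K : Fin 4, dir (K + 2) = -dir K := by decide
  have hgx : dartTip d₀ + dir (d₀.2 + 1 + 1) = d₀.1 := by
    rw [(tp_fin4 _).1, hneg, dartTip]; abel
  obtain ⟨eS, hceS, hendS⟩ := se_corner_edge (dartTip d₀) (d₀.2 + 1)
  rw [hgx] at hendS
  have hopen := (tc_spoke_open (ι.model V) hXarc (K := d₀.2) ht₀ hendS.symm).2
  have hσEX : σ (toSite (dartTip d₀), d₀.2 + 1) = (toSite d₀.1, d₀.2) := by
    rw [hσ, nextCorner_of_mem ((se_cTgt_mem_cfgOf_iff (ι.model V) ω hceS).2 (Or.inr hopen))]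
    simp only
    rw [← se_toSite_add_dir, hgx, (tp_fin4 _).2.2.2.2.1]
  -- the position `j` of `e_X` on the orbit of `e_v''`; its predecessor is untracked
  have hm0 : m ≠ 0 := by
    rintro rfl
    have h := congrArg Prod.fst hm
    simp only [Function.iterate_zero, id_eq, toSite_inj] at h
    obtain ⟨ht1, -, -, -, hp1, -⟩ := ei_rail hadm hflat hout hsink (t := 1) (by omega)
      (by rw [hs2, hs1]; decide)
    have hX : d₀.1 = ((dsucc V)^[1] d₀).1 - dir (((dsucc V)^[1] d₀).2 + 1) := by
      have := congrArg Prod.fst (hp1 le_rfl)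
      simpa [cycle] using this
    rw [h] at hX
    have hdz : ∀ j : Fin 4, dir j ≠ 0 := by decide
    exact hdz _ (sub_eq_self.1 hX.symm)
  obtain ⟨j, rfl⟩ : ∃ j, m = j + 1 := ⟨m - 1, by omega⟩
  have hjX : σ^[j] (toSite ((dsucc V)^[1] d₀).1, ((dsucc V)^[1] d₀).2) = (toSite (dartTip d₀), d₀.2 + 1) := hinj (by rw [← Function.iterate_succ_apply' σ j, hm, hσEX])
  have hj0 : j ≠ 0 := by
    rintro rfl
    exact absurd (congrArg Prod.fst hjX) (fun h => ht₀ (toSite_inj.1 h ▸ (hext 1).1))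
  obtain ⟨j', rfl⟩ : ∃ j', j = j' + 1 := ⟨j - 1, by omega⟩
  have hpred : σ^[j'] (toSite ((dsucc V)^[1] d₀).1, ((dsucc V)^[1] d₀).2) = (toSite (dartTip d₀), d₀.2) :=
    hinj (by rw [← Function.iterate_succ_apply' σ j', hjX, hσX])
  have hun : ¬(ι.model V).IsTracked (σ^[j'] (toSite ((dsucc V)^[1] d₀).1, ((dsucc V)^[1] d₀).2)) := by rw [hpred]; exact hnX
  -- the strand `e_v'' → e_A` occupies the tracked positions `0 … nA`, so `j' > nA`
  have htrS : ∀ i ≤ nA, (ι.model V).IsTracked (σ^[i] (toSite ((dsucc V)^[1] d₀).1, ((dsucc V)^[1] d₀).2)) := ei_isTracked_iterate hω htr2 nA hbefA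
  have hjA : nA < j' := by
    by_contra h
    exact hun (htrS j' (by omega))
  -- the last tracked position `i₀ ∈ [nA, j')`: an exit, `e_A` or `e_C`
  obtain ⟨i₀, hi1, hi2, hti, huns⟩ := ei_exists_last_tracked (ι.model V) σ (toSite ((dsucc V)^[1] d₀).1, ((dsucc V)^[1] d₀).2) hjA (htrS nA le_rfl) hun
  have hexit := ei_exit_cases hadm hflat hchart hv₀ ht₀ hout h2 hAB hBC hCP hcA hcB hcC hsrc hlegs hsink hsl hω hti
    (by have := huns (i₀ + 1) (by omega) (by omega); rwa [Function.iterate_succ_apply'] at this)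
  -- the vertex level is constant from position `i₀` to position `j'`
  have hlev : (ι.collar V).vertH (ofSite (σ^[j'] (toSite ((dsucc V)^[1] d₀).1, ((dsucc V)^[1] d₀).2)).1) = (ι.collar V).vertH (ofSite (σ^[i₀] (toSite ((dsucc V)^[1] d₀).1, ((dsucc V)^[1] d₀).2)).1) := by
    have hcut : (ι.model V).IsCut (σ^[i₀] (toSite ((dsucc V)^[1] d₀).1, ((dsucc V)^[1] d₀).2)) := by
      rcases hexit with h | h
      · rw [h]; exact hAc
      · rw [h]; exact hCc
    have step1 : (ι.collar V).vertH (ofSite (σ^[i₀ + 1] (toSite ((dsucc V)^[1] d₀).1, ((dsucc V)^[1] d₀).2)).1) =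
        (ι.collar V).vertH (ofSite (σ^[i₀] (toSite ((dsucc V)^[1] d₀).1, ((dsucc V)^[1] d₀).2)).1) := by
      rw [Function.iterate_succ_apply']
      exact ei_vertH_nextCorner_of_not_targetsLive hadm hflat hchart hω hcut.1
    have step2 := ei_vertH_iterate_of_not_isTracked hadm hflat hchart hω (c := σ^[i₀ + 1] (toSite ((dsucc V)^[1] d₀).1, ((dsucc V)^[1] d₀).2))
      (n := j' - (i₀ + 1)) (fun m' hm' => by
        rw [← Function.iterate_add_apply]
        exact huns _ (by omega) (by omega))
    rw [← Function.iterate_add_apply, show j' - (i₀ + 1) + (i₀ + 1) = j' by omega] at step2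
    exact step2.trans step1
  rw [hpred] at hlev
  simp only [ofSite_toSite] at hlev
  rw [hgX] at hlev
  rcases hexit with hEA | hEC
  · -- exit at `e_A`: `vertH g_X = vertH g_A`
    rw [hEA] at hlev
    simp only [ofSite_toSite] at hlev
    rw [hgA] at hlev
    exact absurd hlev (by decide)
  · -- exit at `e_C`: the loop closes up inside the stretch `e_C … e_X … e_C`
    have hXC : σ^[j' + 1 + nX] (toSite ((dsucc V)^[1] d₀).1, ((dsucc V)^[1] d₀).2) = (toSite (dartTip ((dsucc V)^[iC] d₀)), ((dsucc V)^[iC] d₀).2 + 2) := by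
      rw [Nat.add_comm, Function.iterate_add_apply, hjX, hitX]
    set p := Function.minimalPeriod σ (toSite ((dsucc V)^[1] d₀).1, ((dsucc V)^[1] d₀).2) with hpdef
    have hppos : 0 < p := Function.minimalPeriod_pos_of_mem_periodicPts hp
    -- positions of `e_C` agree modulo the period
    have hmodC : i₀ % p = (j' + 1 + nX) % p := by
      apply Function.iterate_injOn_Iio_minimalPeriod (f := σ) (x := (toSite ((dsucc V)^[1] d₀).1, ((dsucc V)^[1] d₀).2))
      · exact Nat.mod_lt _ hppos
      · exact Nat.mod_lt _ hppos
      · simp only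
        rw [Function.iterate_mod_minimalPeriod_eq, Function.iterate_mod_minimalPeriod_eq, hEC, hXC]
    -- the first multiple `t` of `p` after `i₀` lies in `(i₀, j' + 1 + nX]`
    have hle : i₀ + p ≤ j' + 1 + nX := by
      have h1 : i₀ < j' + 1 + nX := by omega
      have h2 : p ∣ (j' + 1 + nX) - i₀ := by
        have := Nat.sub_mod_eq_zero_of_mod_eq hmodC.symm
        exact Nat.dvd_of_mod_eq_zero this
      obtain ⟨q, hq⟩ := h2
      rcases q with _ | q
      · omega
      · have : p ≤ (j' + 1 + nX) - i₀ := by rw [hq]; exact Nat.le_mul_of_pos_right _ (Nat.succ_pos q)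
        omega
    set t := (i₀ / p + 1) * p with htdef
    have ht1 : i₀ < t := by
      rw [htdef, Nat.add_mul, one_mul]
      have := Nat.lt_div_mul_add hppos (a := i₀)
      linarith [Nat.div_mul_le_self i₀ p, Nat.mod_lt i₀ hppos, Nat.div_add_mod i₀ p]
    have ht2 : t ≤ i₀ + p := by
      rw [htdef, Nat.add_mul, one_mul]
      exact Nat.add_le_add_right (Nat.div_mul_le_self i₀ p) p
    have htfix : σ^[t] (toSite ((dsucc V)^[1] d₀).1, ((dsucc V)^[1] d₀).2) = (toSite ((dsucc V)^[1] d₀).1, ((dsucc V)^[1] d₀).2) :=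
      ((Function.isPeriodicPt_minimalPeriod σ (toSite ((dsucc V)^[1] d₀).1, ((dsucc V)^[1] d₀).2)).const_mul (i₀ / p + 1)).eq
    -- `t` is not in the untracked stretch `(i₀, j']`
    have htj : j' < t := by
      by_contra h
      exact huns t ht1 (by omega) (by rw [htfix]; exact htr2)
    -- so `e_v''` sits on the strand of `e_X`, at offset `t - (j' + 1) ≤ nX`
    have hoff : σ^[t - (j' + 1)] (toSite (dartTip d₀), d₀.2 + 1) = (toSite ((dsucc V)^[1] d₀).1, ((dsucc V)^[1] d₀).2) := by
      rw [← hjX, ← Function.iterate_add_apply, show t - (j' + 1) + (j' + 1) = t by omega, htfix]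
    rcases Nat.eq_zero_or_pos (t - (j' + 1)) with h0 | hpos
    · rw [h0] at hoff
      exact absurd (congrArg Prod.fst hoff).symm (fun h => ht₀ (toSite_inj.1 h ▸ (hext 1).1))
    · -- its predecessor on the strand is a non-cut, but the predecessor of `e_v''` is the cut `e_v'`
      obtain ⟨u, hu⟩ : ∃ u, t - (j' + 1) = u + 1 := ⟨t - (j' + 1) - 1, by omega⟩
      rw [hu, Function.iterate_succ_apply'] at hoff
      have hpre : σ^[u] (toSite (dartTip d₀), d₀.2 + 1) = (toSite ((dsucc V)^[1] d₀).1, ((dsucc V)^[1] d₀).2 + 3) := hinj (hoff.trans h1n.symm)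
      have hncut := hbefX u (by omega)
      rw [hpre] at hncut
      exact hncut h1c

include hadm hflat hchart hv₀ ht₀ hout h2 hAB hBC hCP hcA hcB hcC hsrc hlegs hsink hsl in
/-- **The rainbow pairing joins the jump vertex to the level `-1` block (`v ≈ W₁`).**
[cite: BaxterKellandWu1976, §3–§4] -/
theorem ei_joined_W1_of_pairing {ω : Finset ((ℤ × ℤ) × Bool)} (hω : ω ⊆ (ι.model V).E)
    (hJA : (ι.model V).Joined ω (toSite ((dsucc V)^[1] d₀).1, ((dsucc V)^[1] d₀).2) (toSite (dartTip ((dsucc V)^[iA] d₀)), ((dsucc V)^[iA] d₀).2 + 2)) (hJB : (ι.model V).Joined ω (toSite (dartTip ((dsucc V)^[iB] d₀)), ((dsucc V)^[iB] d₀).2 + 1) (toSite ((dsucc V)^[1] d₀).1, ((dsucc V)^[1] d₀).2 + 3)) (hJX : (ι.model V).Joined ω (toSite (dartTip d₀), d₀.2 + 1) (toSite (dartTip ((dsucc V)^[iC] d₀)), ((dsucc V)^[iC] d₀).2 + 2)) :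
    ∃ x, (∃ s, iA ≤ s ∧ s ≤ iB ∧ ((dsucc V)^[s] d₀).1 = x) ∧ Relation.ReflTransGen (fun b c : ℤ × ℤ ↦ ∃ e ∈ ω, (e.1 = b ∧ SixVertex.edgeTip e = c) ∨ (e.1 = c ∧ SixVertex.edgeTip e = b)) ((dsucc V)^[1] d₀).1 x := by
  have hsep := ei_sep_of_pairing hadm hflat hchart hv₀ ht₀ hout h2 hAB hBC hCP hcA hcB hcC hsrc hlegs hsink hsl hω hJA hJB hJX
  obtain ⟨hgA, -, -, -⟩ := ei_ghost_levels hadm hflat hchart hv₀ ht₀ hout h2 hAB hBC hCP hcA hcB hcC hsrc hlegs hsink hsl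
  have hext : ∀ i, ((dsucc V)^[i] d₀).1 ∈ V ∧ dartTip ((dsucc V)^[i] d₀) ∉ V :=
    fun i => (s3_dsucc_iterate V i).1 d₀ hv₀ ht₀
  have hPQ : ∀ a ∈ (ι.model V).arcVerts, ((ι.collar V).vertH a = -1 ∧ (fun x => (∃ s, iA ≤ s ∧ s ≤ iB ∧ ((dsucc V)^[s] d₀).1 = x)) a) ∨
      ((ι.collar V).vertH a ≠ -1 ∧ (fun y => (y = d₀.1 ∨ ∃ s, iC ≤ s ∧ s < period V d₀ ∧ ((dsucc V)^[s] d₀).1 = y)) a) := by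
    intro a ha
    rcases ei_arc_level hadm hflat hchart hv₀ ht₀ hout h2 hAB hBC hCP hcA hcB hcC hsrc hlegs hsink hsl ha with ⟨h, hw⟩ | ⟨h, hw⟩
    · exact Or.inl ⟨h, hw⟩
    · exact Or.inr ⟨by rw [h]; decide, hw⟩
  have hsep' : ∀ w a, (fun x => (∃ s, iA ≤ s ∧ s ≤ iB ∧ ((dsucc V)^[s] d₀).1 = x)) w → (fun y => (y = d₀.1 ∨ ∃ s, iC ≤ s ∧ s < period V d₀ ∧ ((dsucc V)^[s] d₀).1 = y)) a → ¬Relation.ReflTransGen (fun b c : ℤ × ℤ ↦ ∃ e ∈ ω, (e.1 = b ∧ SixVertex.edgeTip e = c) ∨ (e.1 = c ∧ SixVertex.edgeTip e = b)) w a :=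
    fun w a hw ha hJ => hsep ⟨a, ha, w, hw, ei_joinedIn_symm hJ⟩
  have hcl := ei_class_reachable hadm hflat hchart hω (-1) _ _ hPQ hsep' (ei_reachable_of_joined hJA).symm
    (Or.inr ⟨by simpa using (hext iA).2, by simpa using hgA⟩)
  simp only [ofSite_toSite] at hcl
  rcases hcl with ⟨-, w, hw, hJ⟩ | ⟨hv, -⟩
  · exact ⟨w, hw, ei_joinedIn_symm hJ⟩
  · exact absurd (hext 1).1 hv

end RainbowToHull

/-- **Registered form of `ei_sep_of_pairing`** (landing anchor, all hypotheses explicit).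
[cite: BaxterKellandWu1976, §3–§4] -/
theorem ei_sep_of_pairing_explicit {ι : LegInsertionData} {V : Finset (ℤ × ℤ)} {d₀ : Dart} {iA iB iC : ℕ}
    (hadm : ι.IsAdmissible V)
    (hflat : ∀ x ∈ insert ι.sink ι.source, ∃ dvec : ℤ × ℤ,
      (dvec = (1, 0) ∨ dvec = (-1, 0) ∨ dvec = (0, 1) ∨ dvec = (0, -1)) ∧
      ∀ v : ℤ × ℤ, (v.1 - x.1) ^ 2 + (v.2 - x.2) ^ 2 ≤ ((ι.sinkLegs : ℤ) + 3) ^ 2 →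
        (v ∈ V ↔ 0 ≤ (v.1 - x.1) * dvec.1 + (v.2 - x.2) * dvec.2))
    (hchart : ∀ u ∈ V, ∀ k : Fin 4, u + dir k ∉ V → ∃ (K : Fin 4) (c₁ c₂ : ℤ),
      (∀ v : ℤ × ℤ, |v.1 - u.1| ≤ 3 → |v.2 - u.2| ≤ 3 →
        (v ∈ V ↔ c₂ ≤ v.1 * (dir (K + 1)).1 + v.2 * (dir (K + 1)).2)) ∨
      (∀ v : ℤ × ℤ, |v.1 - u.1| ≤ 3 → |v.2 - u.2| ≤ 3 →
        (v ∈ V ↔ c₁ ≤ v.1 * (dir K).1 + v.2 * (dir K).2 ∧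
          c₂ ≤ v.1 * (dir (K + 1)).1 + v.2 * (dir (K + 1)).2)) ∨
      (∀ v : ℤ × ℤ, |v.1 - u.1| ≤ 3 → |v.2 - u.2| ≤ 3 →
        (v ∈ V ↔ c₂ ≤ v.1 * (dir (K + 1)).1 + v.2 * (dir (K + 1)).2 ∨
          v.1 * (dir K).1 + v.2 * (dir K).2 ≤ c₁)))
    (hv₀ : d₀.1 ∈ V) (ht₀ : dartTip d₀ ∉ V) (hout : outDart V d₀.1 = some d₀)
  (h2 : 2 ≤ iA) (hAB : iA < iB) (hBC : iB < iC) (hCP : iC < period V d₀)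
  (hcA : ((neighbours ((dsucc V)^[iA] d₀).1).filter (fun y ↦ y ∉ V)).card = 1)
  (hcB : ((neighbours ((dsucc V)^[iB] d₀).1).filter (fun y ↦ y ∉ V)).card = 1)
  (hcC : ((neighbours ((dsucc V)^[iC] d₀).1).filter (fun y ↦ y ∉ V)).card = 1)
  (hsrc : ι.source = {((dsucc V)^[iA] d₀).1, ((dsucc V)^[iB] d₀).1, ((dsucc V)^[iC] d₀).1})
  (hlegs : ∀ x ∈ ι.source, ι.legs x = 1) (hsink : ι.sink = d₀.1) (hsl : ι.sinkLegs = 3) {ω : Finset ((ℤ × ℤ) × Bool)} (hω : ω ⊆ (ι.model V).E)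
    (hJA : (ι.model V).Joined ω (toSite ((dsucc V)^[1] d₀).1, ((dsucc V)^[1] d₀).2) (toSite (dartTip ((dsucc V)^[iA] d₀)), ((dsucc V)^[iA] d₀).2 + 2)) (hJB : (ι.model V).Joined ω (toSite (dartTip ((dsucc V)^[iB] d₀)), ((dsucc V)^[iB] d₀).2 + 1) (toSite ((dsucc V)^[1] d₀).1, ((dsucc V)^[1] d₀).2 + 3)) (hJX : (ι.model V).Joined ω (toSite (dartTip d₀), d₀.2 + 1) (toSite (dartTip ((dsucc V)^[iC] d₀)), ((dsucc V)^[iC] d₀).2 + 2)) :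
    ¬∃ y, (y = d₀.1 ∨ ∃ s, iC ≤ s ∧ s < period V d₀ ∧ ((dsucc V)^[s] d₀).1 = y) ∧ ∃ x, (∃ s, iA ≤ s ∧ s ≤ iB ∧ ((dsucc V)^[s] d₀).1 = x) ∧ Relation.ReflTransGen (fun b c : ℤ × ℤ ↦ ∃ e ∈ ω, (e.1 = b ∧ SixVertex.edgeTip e = c) ∨ (e.1 = c ∧ SixVertex.edgeTip e = b)) y x :=
  ei_sep_of_pairing hadm hflat hchart hv₀ ht₀ hout h2 hAB hBC hCP hcA hcB hcC hsrc hlegs hsink hsl hω hJA hJB hJX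

end Summit.CriticalPhenomena.CardyFormulaZ2.Cruxes.RectilinearCardy.ExcursionKernelCovariance
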